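import Mathlib
import Literature.NumberTheory.LFunctions.MultiplicativeAutomatic

/-!
# Crux `DigitPolyUniformity` (stmt-QuantumAdvantage-1392), automatic phases: from
# `λ`-orthogonality at every `N` to the dyadic crux form

Elementary passage used by line Sketch of the crux for the class of AUTOMATIC phases (modulo
Müllner 2017). Suppose every `2`-automatic complex sequence `a` is orthogonal to the Liouville
function in the `ε–N₀` form `‖Σ_{n ≤ N} a(n) λ(n)‖ ≤ ε N` for `N ≥ N₀(a, ε)`. Then for every REAL
weight `φ` whose complexification is `2`-automatic and every `ε > 0`, eventually in `n`,
`|Σ_{N < 2ⁿ} λ(N) φ(N)| ≤ ε 2ⁿ`: specialise to `N = 2ⁿ − 1` (so `range (N + 1) = range (2ⁿ)`),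
which is `≥ N₀` as soon as `n ≥ N₀ + 1` (`n < 2ⁿ`), identify the complex sum with the cast of the
real one, and bound `ε (2ⁿ − 1) ≤ ε 2ⁿ`.
-/

set_option linter.dupNamespace false -- D-0017: single-problem summit ⇒ QuantumAdvantage.QuantumAdvantage by design

namespace Summit.QuantumAdvantage.QuantumAdvantage.Theorems.MobiusLadder

open Filter Finset

namespace AutomaticDyadic

/-- The complex correlation sum `Σ_{N ∈ s} φ(N) λ(N)` of a real weight `φ` is the cast of the real
sum `Σ_{N ∈ s} λ(N) φ(N)`. [folklore] -/
theorem sum_ofReal_mul_liouville (φ : ℕ → ℝ) (s : Finset ℕ) :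
    ∑ N ∈ s, (φ N : ℂ) * (ArithmeticFunction.liouville N : ℂ) =
      ((∑ N ∈ s, ((ArithmeticFunction.liouville N : ℤ) : ℝ) * φ N : ℝ) : ℂ) := by
  rw [Complex.ofReal_sum]
  refine Finset.sum_congr rfl fun N _ => ?_
  push_cast
  ring

/-- `N₀ ≤ 2ⁿ − 1` as soon as `N₀ + 1 ≤ n`, since `n < 2ⁿ`. [folklore] -/
theorem le_two_pow_sub_one {N₀ n : ℕ} (h : N₀ + 1 ≤ n) : N₀ ≤ 2 ^ n - 1 := by
  have := Nat.lt_two_pow_self (n := n)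
  omega

/-- `((2ⁿ − 1 : ℕ) : ℝ) ≤ 2ⁿ`. [folklore] -/
theorem cast_two_pow_sub_one_le (n : ℕ) : ((2 ^ n - 1 : ℕ) : ℝ) ≤ (2 : ℝ) ^ n := by
  calc ((2 ^ n - 1 : ℕ) : ℝ) ≤ ((2 ^ n : ℕ) : ℝ) := by exact_mod_cast Nat.sub_le _ _
    _ = (2 : ℝ) ^ n := by push_cast; ring

end AutomaticDyadic

/-- **Automatic phases, dyadic form.** If every `2`-automatic complex sequence `a` satisfies
`‖Σ_{n ≤ N} a(n) λ(n)‖ ≤ ε N` for all `N ≥ N₀(a, ε)`, then for every real weight `φ : ℕ → ℝ` whose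
complexification `N ↦ (φ N : ℂ)` is `2`-automatic and every `ε > 0`, eventually in `n`,
`|Σ_{N < 2ⁿ} λ(N) φ(N)| ≤ ε · 2ⁿ`. Proof: apply the hypothesis to `a = φ` at `N = 2ⁿ − 1 ≥ N₀`
(valid once `n ≥ N₀ + 1`, as `n < 2ⁿ`), so that `range (N + 1) = range (2ⁿ)`; the complex sum is
the cast of the real sum, its norm is the absolute value, and `ε (2ⁿ − 1) ≤ ε 2ⁿ`. [folklore] -/
theorem digitPolyUniformity_automatic_of_liouville :
    (∀ a : ℕ → ℂ, Literature.NumberTheory.LFunctions.IsAutomaticSeq 2 a → ∀ ε : ℝ, 0 < ε →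
      ∃ N₀ : ℕ, ∀ N : ℕ, N₀ ≤ N →
        ‖∑ n ∈ Finset.range (N + 1), a n * (ArithmeticFunction.liouville n : ℂ)‖ ≤ ε * N) →
    ∀ φ : ℕ → ℝ, Literature.NumberTheory.LFunctions.IsAutomaticSeq 2 (fun N => (φ N : ℂ)) →
      ∀ ε : ℝ, 0 < ε → ∀ᶠ n : ℕ in Filter.atTop,
        |∑ N ∈ Finset.range (2 ^ n), ((ArithmeticFunction.liouville N : ℤ) : ℝ) * φ N| ≤
          ε * (2 : ℝ) ^ n := by
  intro h φ hφ ε hε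
  obtain ⟨N₀, hN₀⟩ := h (fun N => (φ N : ℂ)) hφ ε hε
  refine (Filter.eventually_ge_atTop (N₀ + 1)).mono fun n hn => ?_
  have key : ‖∑ k ∈ Finset.range (2 ^ n - 1 + 1),
      (φ k : ℂ) * (ArithmeticFunction.liouville k : ℂ)‖ ≤ ε * ((2 ^ n - 1 : ℕ) : ℝ) :=
    hN₀ (2 ^ n - 1) (AutomaticDyadic.le_two_pow_sub_one hn)
  rw [Nat.sub_add_cancel Nat.one_le_two_pow, AutomaticDyadic.sum_ofReal_mul_liouville,
    Complex.norm_real, Real.norm_eq_abs] at key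
  exact key.trans (mul_le_mul_of_nonneg_left (AutomaticDyadic.cast_two_pow_sub_one_le n) hε.le)

end Summit.QuantumAdvantage.QuantumAdvantage.Theorems.MobiusLadder
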